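import Summits.Ventures.PercRepro.SwapSets

/-!
# The K-swap of Gladkov–Zimin at the class level (mine-3's GZ-swap reduction for C-017, §8)

`conjectures`/`proofs/MINE3-C017-classlemma.md` §8 reduces the C-017 class lemma to a pairing of the
configurations of a marked multigraph: for a red set `S ⊆ E` (a configuration `ω`, open = red) and
`K = Com_a(S)` the open cluster of `a`, the **K-swap** `σ₀(S) := S Δ E[K]` flips every edge with an
endpoint in `K` (Gladkov–Zimin, arXiv:2404.08873 Lemma 4.2: the decision tree «explore `Com_a(C₁)` with
side `C₂`, everything else side `C₁`», at the class level).

* `kSwap a ω` — the K-swap (p5's `edgesAt X` = the edges with an endpoint in `X`, SwapSets.lean);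
* **`cluster_compl_kSwap`** — the cut lemma: the cluster of `a` in the complement of `σ₀(S)` is `K`
  again (on `E[K]` the complement of `σ₀(S)` agrees with `S`; `K` is a cluster, so no open edge leaves
  it); hence **`conn_compl_kSwap_iff`** (`a ~ b` in `σ₀(S)‾` iff `a ~_S b`);
* **`kSwap_injective`** / **`kSwap_bijective`** — Theorem 8.1's bijection (the inverse is
  `T ↦ T Δ E[Com_a(T̄)]`);
* **`card_conn_sep_eq_card_sep_conn_kSwap`** (THEOREM 8.1, the pairing):
  `#{S : a ~_S b, a ≁_{S̄} b} = #{S : a ≁_S b, a ~_{σ₀(S)} b}` — the left side is the «bad» count of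
  the C-017 class lemma (§1, form (L1)), the right side its GZ-swap form;
* the sealed swap `kSwapSealed a c ω` (`σ₇₂`: the edges at `K` not at `M = Com_c(S)` flipped), its decoder
  `kSwapSealedInv` (**`kSwapSealed_injective`**, Lemma 8.2a), **`onePair_kSwapSealed_of_bot`** (Lemma 8.2b),
  the decodable map `phiDecodable` (**`phiDecodable_injOn`**, THEOREM 8.2c) and the residual corollary
  **`card_bad_le_of_bot2`**;
* THEOREM 8.3 on the residual `Bot2`: `Q = Com_a(σ₇₂ S)` misses `L` and `M` (**`not_mem_cluster_b_of_bot2`**,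
  **`not_mem_cluster_c_of_bot2`**, (i)), no edge joins `Q ∩ K` to `L` (**`no_edge_Q_K_L_of_bot2`**, (ii)), some
  closed edge joins `Q ∩ K` to `M` (**`exists_edge_Q_K_M_of_bot2`**, (iii)), `σ₄₀(S)` has the cell `ac|b`
  (**`cell_kSwapSealed_b_of_bot2`**, (iv)) and mine-3's rule `R***` (`rStar`) sends `bot-2` into the
  non-bad part of `ac|b` (**`rStar_of_bot2`**, (v), §8.8).
* mine-3's RULE `R4` (§8.10): `R4Added` / `rFour` (`S` plus every edge from `Q ∩ K` to a vertex outside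
  `K ∪ L`), **`cell_rFour_of_bot2`** (cell `ac|b`), **`not_bad_rFour_of_bot2`** and **`rFour_of_bot2`**;
* `bot-1 ⊆ BAD` (ref-1's note: the sheet's `bot-1` omits «bad»): **`kSwapSealed_le_kSwap_of_not_conn`**
  (`σ₇₂(S) ⊆ σ₀(S)` whenever `a ≁_S c`), **`bad_of_isBot_of_conn_kSwapSealed`** (bot-1 is bad, by
  monotonicity of connection) and `bot2_or_conn_kSwapSealed_of_isBot` (a bad `bot` configuration is
  `bot-1` or `bot-2`);
-/

namespace PercRepro

namespace MultiGraph

section KSwap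

variable {V E : Type*} (G : MultiGraph V E)

open Classical in
/-- **The K-swap** `σ₀(S) = S Δ E[Com_a(S)]`: every edge with an endpoint in the open cluster of `a`
is flipped, every other edge is kept. -/
noncomputable def kSwap (a : V) (ω : Config E) : Config E :=
  fun e => if e ∈ G.edgesAt (G.cluster ω a) then !ω e else ω e

/-- The K-swap flips the edges at the cluster of `a`. -/
theorem kSwap_apply_of_mem {a : V} {ω : Config E} {e : E} (he : e ∈ G.edgesAt (G.cluster ω a)) :
    G.kSwap a ω e = !ω e := by
  simp [kSwap, he]

/-- The K-swap keeps the edges away from the cluster of `a`. -/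
theorem kSwap_apply_of_notMem {a : V} {ω : Config E} {e : E}
    (he : e ∉ G.edgesAt (G.cluster ω a)) : G.kSwap a ω e = ω e := by
  simp [kSwap, he]

/-- The complement of a configuration, pointwise (a local copy of typer-2's `compl_apply_bool`). -/
theorem compl_apply_not (ρ : Config E) (e : E) : ρᶜ e = !ρ e := by
  rw [Pi.compl_apply]
  cases ρ e <;> rfl

/-- On `E[K]` the complement of the K-swap agrees with `ω`. -/
theorem compl_kSwap_apply_of_mem {a : V} {ω : Config E} {e : E}
    (he : e ∈ G.edgesAt (G.cluster ω a)) : (G.kSwap a ω)ᶜ e = ω e := by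
  rw [compl_apply_not, G.kSwap_apply_of_mem he, Bool.not_not]

/-- Off `E[K]` the complement of the K-swap is the complement of `ω`. -/
theorem compl_kSwap_apply_of_notMem {a : V} {ω : Config E} {e : E}
    (he : e ∉ G.edgesAt (G.cluster ω a)) : (G.kSwap a ω)ᶜ e = !ω e := by
  rw [compl_apply_not, G.kSwap_apply_of_notMem he]

/-- An open edge with one endpoint in a cluster has both endpoints in it. -/
theorem mem_cluster_iff_of_open {ω : Config E} {a : V} {e : E} (he : ω e = true) :
    G.fst e ∈ G.cluster ω a ↔ G.snd e ∈ G.cluster ω a := by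
  simp only [mem_cluster]
  constructor
  · intro h
    exact h.trans (Conn.of_openAdj (G.openAdj_of_open e he))
  · intro h
    exact h.trans (Conn.of_openAdj (G.openAdj_of_open e he).symm)

/-- **The cut lemma**: the cluster of `a` in the complement of the K-swap is the cluster of `a` in `ω`
(p5's `cluster_eq_of_agree`: the complement of the swap agrees with `ω` on every edge at `K`). -/
theorem cluster_compl_kSwap (a : V) (ω : Config E) :
    G.cluster (G.kSwap a ω)ᶜ a = G.cluster ω a :=
  cluster_eq_of_agree fun _ he => (G.compl_kSwap_apply_of_mem he).symm

/-- `a ~ b` in the complement of the K-swap iff `a ~ b` in `ω`. -/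
theorem conn_compl_kSwap_iff (a b : V) (ω : Config E) :
    G.Conn (G.kSwap a ω)ᶜ a b ↔ G.Conn ω a b := by
  rw [← mem_cluster, ← mem_cluster, G.cluster_compl_kSwap]

/-- **The K-swap is injective** (Theorem 8.1): the cluster `K` is recovered from the complement of the
image, hence the flipped set, hence the original. -/
theorem kSwap_injective (a : V) : Function.Injective (G.kSwap a) := by
  intro ω ω' h
  have hK : G.cluster ω a = G.cluster ω' a := by
    rw [← G.cluster_compl_kSwap a ω, ← G.cluster_compl_kSwap a ω', h]
  funext e
  by_cases he : e ∈ G.edgesAt (G.cluster ω a)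
  · have he' : e ∈ G.edgesAt (G.cluster ω' a) := by rwa [← hK]
    have := congrArg (fun ρ => ρ e) h
    simp only [G.kSwap_apply_of_mem he, G.kSwap_apply_of_mem he'] at this
    exact Bool.not_inj this
  · have he' : e ∉ G.edgesAt (G.cluster ω' a) := by rwa [← hK]
    have := congrArg (fun ρ => ρ e) h
    simpa only [G.kSwap_apply_of_notMem he, G.kSwap_apply_of_notMem he'] using this

variable [Fintype E]

/-- **The K-swap is a bijection** of the finite cube (Theorem 8.1). -/
theorem kSwap_bijective (a : V) : Function.Bijective (G.kSwap a) :=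
  Finite.injective_iff_bijective.mp (G.kSwap_injective a)

variable [DecidableEq E]

open Classical in
/-- **THEOREM 8.1 (the pairing)**: `#{S : a ~_S b, a ≁_{S̄} b} = #{S : a ≁_S b, a ~_{σ₀(S)} b}`. -/
theorem card_conn_sep_eq_card_sep_conn_kSwap (a b : V) :
    (Finset.univ.filter fun ω : Config E => G.Conn ω a b ∧ ¬ G.Conn ωᶜ a b).card =
      (Finset.univ.filter fun ω : Config E => ¬ G.Conn ω a b ∧ G.Conn (G.kSwap a ω) a b).card := by
  let e : Config E ≃ Config E := Equiv.ofBijective (G.kSwap a) (G.kSwap_bijective a)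
  symm
  refine Finset.card_nbij' (fun ω => e ω) (fun τ => e.symm τ) ?_ ?_ ?_ ?_
  · intro ω hω
    simp only [Finset.coe_filter, Finset.mem_univ, true_and, Set.mem_setOf_eq] at hω ⊢
    refine ⟨hω.2, ?_⟩
    show ¬ G.Conn (G.kSwap a ω)ᶜ a b
    rw [G.conn_compl_kSwap_iff]
    exact hω.1
  · intro τ hτ
    simp only [Finset.coe_filter, Finset.mem_univ, true_and, Set.mem_setOf_eq] at hτ ⊢
    have hτ' : G.kSwap a (e.symm τ) = τ := e.apply_symm_apply τ
    constructor
    · rw [← G.conn_compl_kSwap_iff, hτ']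
      exact hτ.2
    · rw [hτ']
      exact hτ.1
  · intro ω _
    exact e.symm_apply_apply ω
  · intro τ _
    exact e.apply_symm_apply τ

end KSwap

end MultiGraph

end PercRepro
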